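import Literature.Analysis.FluidPDE.FractionalNSReynolds
import Literature.Analysis.FluidPDE.FracLaplacianSmooth
import HarnessLib

/-!
# The weak identity with Reynolds defect for the fractional Navier–Stokes–Reynolds system

Analysis/FluidPDE proofs-only complement to `Literature.Analysis.FluidPDE.FractionalNSReynolds`
(`Torus.IsFracNSReynoldsOn S θ ν v p R`: smooth solutions of Luo–Titi's approximate system (2.1),
`∂ₜv + ∇·(v⊗v) + ∇p + ν(-Δ)^θ v = ∇·R`, `∇·v = 0`, `R` symmetric). We prove the identity by
which "since `‖R_q‖_{L^∞_t L¹_x} → 0`, `v` is a weak solution" (Luo–Titi 2020, §2.1, proof of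
Theorem 1): a classical solution of (2.1) satisfies the weak momentum identity of Luo–Titi's
Def. 1.1 (`Torus.IsWeakFracNSSolutionLine`, `FractionalNSTorus`) up to the Reynolds defect
`-∫∫ R : ∇ψ`.

* `IsFracNSReynoldsOn.weak_identity` — on a time set `S ⊇ [T₁, T₂]` (`T₁ < T₂`, `θ ≥ 0`), for a
  test field `ψ` with smooth space–time lift, divergence free at every time, with
  `ψ(T₁) = ψ(T₂) = 0`:
  `∫_{T₁}^{T₂}∫ (⟪v, ∂ₜψ⟫ + ⟪v, (v·∇)ψ⟫ - ν⟪v, (-Δ)^θψ⟫) = ∫_{T₁}^{T₂}∫ ∑ⱼ ⟪R^{(j)}, ∂ⱼψ⟫`;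
* `IsFracNSReynoldsOn.weak_identity_line` — the same on `ℝ × T^d` (`S = univ`) for test fields
  with compact support in time, with `∫_ℝ` on both sides.

Proof as for the tree's `Torus.IsNSReynoldsOn.weak_identity` (`NavierStokesReynolds`):
`E(t) = ∫⟪v(t), ψ(t)⟫` vanishes at both ends, `E' = ∫(⟪v, ∂ₜψ⟫ + ⟪div R - ∇p - (v·∇)v - ν(-Δ)^θv, ψ⟫)`,
and on the torus `∫⟪∇p, ψ⟫ = 0`, `∫⟪(v·∇)v, ψ⟫ = -∫⟪v, (v·∇)ψ⟫`, `∫⟪div R, ψ⟫ = -∫∑ⱼ⟪R^{(j)}, ∂ⱼψ⟫`,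
while the hyperviscous term is moved onto the test field by the symmetry
`∫⟪(-Δ)^θ a, b⟫ = ∫⟪a, (-Δ)^θ b⟫` of `FracLaplacianSmooth` (`Torus.integral_inner_fracLaplacian_comm`).

This is one ingredient of the deduction "Iteration Lemma (`Torus.LuoTiti2020_iterationLemma`)
⇒ Luo–Titi's Theorem 1 ⇒ `LuoTiti2020_infinitelyMany`" (the consequence clause is already
derived from the main clause `LuoTiti2020_thm1` in
`Literature/Barriers/NavierStokesRegularity/LionsExponentSharpnessProofs`); the remaining
ingredient is the passage to the `L^∞_t L²_x` limit along the iteration.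

## References

* T. Luo, E. S. Titi, Calc. Var. PDE 59 (2020), Paper 92 = arXiv:1808.07595, §1 Def. 1.1; §2.1
  (2.1) and the proof of Theorem 1. [`LuoTiti2020`]
-/

noncomputable section

open MeasureTheory Set Filter Topology UnitAddTorus
open scoped ENNReal NNReal InnerProductSpace ContDiff

namespace Literature.Analysis.FluidPDE

namespace Torus

variable {d : Type*} [Fintype d] [DecidableEq d]
variable {S : Set ℝ} {T₁ T₂ θ ν : ℝ} {v : ℝ → UnitAddTorus d → EuclideanSpace ℝ d}
  {p : ℝ → UnitAddTorus d → ℝ} {R : ℝ → UnitAddTorus d → d → EuclideanSpace ℝ d}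

omit [DecidableEq d] in
/-- The time derivative of a test field with smooth space–time lift has a smooth space–time
lift (cf. `Torus.IsSpaceTimeTest.timeDeriv`). [folklore] -/
theorem contDiff_stLift_timeDeriv {F : Type*} [NormedAddCommGroup F] [NormedSpace ℝ F]
    {ψ : ℝ → UnitAddTorus d → F} (hψ : ContDiff ℝ ∞ (FunctionSpaces.Torus.stLift ψ)) :
    ContDiff ℝ ∞ (FunctionSpaces.Torus.stLift (FunctionSpaces.Torus.timeDeriv ψ)) := by
  rw [FunctionSpaces.Torus.stLift_timeDeriv]
  refine ContDiff.fderiv_apply (m := ∞)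
    (f := fun (q : ℝ × EuclideanSpace ℝ d) (τ : ℝ) => FunctionSpaces.Torus.stLift ψ (τ, q.2)) ?_ contDiff_fst
    contDiff_const (le_of_eq rfl)
  exact hψ.comp (contDiff_snd.prodMk (contDiff_snd.comp contDiff_fst))

/-- **The weak identity with Reynolds defect** for classical solutions of the fractional
Navier–Stokes–Reynolds system on a time set `S ⊇ [T₁, T₂]` (`T₁ < T₂`, `θ ≥ 0`): for every test
field `ψ` with smooth space–time lift, divergence free at every time and vanishing at `t = T₁`
and `t = T₂`,
`∫_{T₁}^{T₂} ∫ (⟪v, ∂ₜψ⟫ + ⟪v, (v·∇)ψ⟫ - ν ⟪v, (-Δ)^θ ψ⟫) dx dt = ∫_{T₁}^{T₂} ∫ ∑ⱼ ⟪R^{(j)}, ∂ⱼψ⟫ dx dt`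
— the identity of Luo–Titi's Def. 1.1 up to the defect `-∫∫ R : ∇ψ` ("Since
`‖R_{q+1}‖_{L^∞_t L¹_x} → 0` … `v` is a weak solution", §2.1, proof of Theorem 1). Proof:
`E(t) = ∫⟪v(t), ψ(t)⟫` vanishes at both ends and within `[T₁, T₂]`
`E' = ∫ (⟪v, ∂ₜψ⟫ + ⟪div R - ∇p - (v·∇)v - ν(-Δ)^θ v, ψ⟫)`; on the torus `∫⟪∇p, ψ⟫ = 0`,
`∫⟪(v·∇)v, ψ⟫ = -∫⟪v, (v·∇)ψ⟫`, `∫⟪div R, ψ⟫ = -∫∑ⱼ⟪R^{(j)}, ∂ⱼψ⟫`, and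
`∫⟪(-Δ)^θ v, ψ⟫ = ∫⟪v, (-Δ)^θ ψ⟫` (`Torus.integral_inner_fracLaplacian_comm`).
[cite: LuoTiti2020, §1 Def. 1.1 and §2.1, proof of Theorem 1] -/
theorem IsFracNSReynoldsOn.weak_identity (h : IsFracNSReynoldsOn S θ ν v p R) (hθ : 0 ≤ θ)
    (hS : Icc T₁ T₂ ⊆ S) (hT : T₁ < T₂) {ψ : ℝ → UnitAddTorus d → EuclideanSpace ℝ d}
    (hψ : ContDiff ℝ ∞ (FunctionSpaces.Torus.stLift ψ)) (hψ₁ : ψ T₁ = 0) (hψ₂ : ψ T₂ = 0)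
    (hψdiv : FunctionSpaces.Torus.IsDivFreeTest ψ) :
    ∫ t in Ioo T₁ T₂, ∫ x, (⟪v t x, FunctionSpaces.Torus.timeDeriv ψ t x⟫_ℝ +
        ⟪v t x, FunctionSpaces.Torus.convect (v t) (ψ t) x⟫_ℝ - ν * ⟪v t x, fracLaplacian θ (ψ t) x⟫_ℝ) =
      ∫ t in Ioo T₁ T₂, ∫ x, ∑ j, ⟪R t x j, FunctionSpaces.Torus.partialDeriv j (ψ t) x⟫_ℝ := by
  -- restrict to the time interval `I = [T₁, T₂]`
  have hI := h.mono hS (uniqueDiffOn_Icc hT)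
  set I : Set ℝ := Icc T₁ T₂ with hI_def
  have hU : UniqueDiffOn ℝ I := uniqueDiffOn_Icc hT
  have hv : FunctionSpaces.Torus.IsSmoothSpaceTimeOn I v := hI.smooth_velocity
  have hp : FunctionSpaces.Torus.IsSmoothSpaceTimeOn I p := hI.smooth_pressure
  have hR : FunctionSpaces.Torus.IsSmoothSpaceTimeOn I R := hI.smooth_stress
  have hψI : FunctionSpaces.Torus.IsSmoothSpaceTimeOn I ψ := hψ.contDiffOn
  have hψuniv : FunctionSpaces.Torus.IsSmoothSpaceTimeOn univ ψ := hψ.contDiffOn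
  have hψ' : ContDiff ℝ ∞ (FunctionSpaces.Torus.stLift (FunctionSpaces.Torus.timeDeriv ψ)) :=
    contDiff_stLift_timeDeriv hψ
  have hψ'I : FunctionSpaces.Torus.IsSmoothSpaceTimeOn I (FunctionSpaces.Torus.timeDeriv ψ) := hψ'.contDiffOn
  -- the pairing `E(t) = ∫ ⟪v(t), ψ(t)⟫` and its derivative within `I`
  have hg : FunctionSpaces.Torus.IsSmoothSpaceTimeOn I (fun t x => ⟪v t x, ψ t x⟫_ℝ) := hv.inner hψI
  set E : ℝ → ℝ := fun t => ∫ x, ⟪v t x, ψ t x⟫_ℝ with hE_def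
  set E' : ℝ → ℝ := fun t =>
    ∫ x, FunctionSpaces.Torus.timeDerivWithin I (fun t x => ⟪v t x, ψ t x⟫_ℝ) t x with hE'_def
  have hE : ∀ t ∈ I, HasDerivWithinAt E (E' t) I t := fun t ht =>
    hg.hasDerivWithinAt_integral (convex_Icc T₁ T₂) ht
  have hE'cont : ContinuousOn E' I := hg.continuousOn_integral_timeDerivWithin hU
  have hET₁ : E T₁ = 0 := by
    simp only [hE_def, hψ₁, Pi.zero_apply, inner_zero_right, integral_zero]
  have hET₂ : E T₂ = 0 := by
    simp only [hE_def, hψ₂, Pi.zero_apply, inner_zero_right, integral_zero]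
  have hFTC : ∫ t in Ioo T₁ T₂, E' t = 0 := by
    rw [← integral_Ioc_eq_integral_Ioo, ← intervalIntegral.integral_of_le hT.le,
      intervalIntegral.integral_eq_sub_of_hasDerivAt_of_le hT.le
        (fun t ht => (hE t ht).continuousWithinAt)
        (fun t ht => (hE t (Ioo_subset_Icc_self ht)).hasDerivAt (Icc_mem_nhds ht.1 ht.2))
        ((hE'cont.mono (uIcc_of_le hT.le).subset).intervalIntegrable),
      hET₁, hET₂, sub_zero]
  -- the space-integrated terms, continuous in time on `I`
  set A₁ : ℝ → ℝ := fun t => ∫ x, (⟪v t x, FunctionSpaces.Torus.timeDeriv ψ t x⟫_ℝ +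
    ⟪v t x, FunctionSpaces.Torus.convect (v t) (ψ t) x⟫_ℝ) with hA₁_def
  set A₂ : ℝ → ℝ := fun t => ∫ x, ⟪v t x, fracLaplacian θ (ψ t) x⟫_ℝ with hA₂_def
  set B : ℝ → ℝ := fun t => ∫ x, ∑ j, ⟪R t x j, FunctionSpaces.Torus.partialDeriv j (ψ t) x⟫_ℝ with hB_def
  have hA₁sm : FunctionSpaces.Torus.IsSmoothSpaceTimeOn I (fun t x => ⟪v t x, FunctionSpaces.Torus.timeDeriv ψ t x⟫_ℝ +
      ⟪v t x, FunctionSpaces.Torus.convect (v t) (ψ t) x⟫_ℝ) :=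
    (hv.inner hψ'I).add (hv.inner (hv.convect hψI hU))
  have hBsm : FunctionSpaces.Torus.IsSmoothSpaceTimeOn I
      (fun t x => ∑ j, ⟪R t x j, FunctionSpaces.Torus.partialDeriv j (ψ t) x⟫_ℝ) :=
    FunctionSpaces.Torus.IsSmoothSpaceTimeOn.sum fun j _ => (hR.column j).inner (hψI.partialDeriv hU j)
  have hA₁cont : ContinuousOn A₁ I := hA₁sm.continuousOn_integral (convex_Icc T₁ T₂)
  have hA₂cont : ContinuousOn A₂ I :=
    continuousOn_integral_inner_fracLaplacian hθ hψuniv hv.continuousOn_stLift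
  have hBcont : ContinuousOn B I := hBsm.continuousOn_integral (convex_Icc T₁ T₂)
  have hIint : ∀ {F : ℝ → ℝ}, ContinuousOn F I → IntegrableOn F (Ioo T₁ T₂) volume := fun hF =>
    (hF.integrableOn_compact isCompact_Icc).mono_set Ioo_subset_Icc_self
  have hA₁int := hIint hA₁cont
  have hA₂int := hIint hA₂cont
  have hBint := hIint hBcont
  -- pointwise in time: `E' t = A₁ t - ν A₂ t - B t` and the goal's integrand is `A₁ t - ν A₂ t`
  have hkey : ∀ t ∈ Ioo T₁ T₂, E' t = A₁ t - ν * A₂ t - B t ∧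
      (∫ x, (⟪v t x, FunctionSpaces.Torus.timeDeriv ψ t x⟫_ℝ +
        ⟪v t x, FunctionSpaces.Torus.convect (v t) (ψ t) x⟫_ℝ - ν * ⟪v t x, fracLaplacian θ (ψ t) x⟫_ℝ)) =
        A₁ t - ν * A₂ t := by
    intro t ht
    have htI : t ∈ I := Ioo_subset_Icc_self ht
    have hvt : FunctionSpaces.Torus.IsSmooth (v t) := hv.isSmooth_slice htI
    have hpt : FunctionSpaces.Torus.IsSmooth (p t) := hp.isSmooth_slice htI
    have hRt : FunctionSpaces.Torus.IsSmooth (R t) := hR.isSmooth_slice htI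
    have hψt : FunctionSpaces.Torus.IsSmooth (ψ t) := hψI.isSmooth_slice htI
    have hψ't : FunctionSpaces.Torus.IsSmooth (FunctionSpaces.Torus.timeDeriv ψ t) := hψ'I.isSmooth_slice htI
    have hΛv : Continuous (fracLaplacian θ (v t)) := continuous_fracLaplacian hθ hvt
    have hΛψ : Continuous (fracLaplacian θ (ψ t)) := continuous_fracLaplacian hθ hψt
    -- `∂ₜ⟪v, ψ⟫ = ⟪v, ∂ₜψ⟫ + ⟪div R - ∇p - (v·∇)v - ν(-Δ)^θ v, ψ⟫`
    have hslice : ∀ x, FunctionSpaces.Torus.timeDerivWithin I (fun t x => ⟪v t x, ψ t x⟫_ℝ) t x =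
        ⟪v t x, FunctionSpaces.Torus.timeDeriv ψ t x⟫_ℝ +
          ⟪tensorDivergence (R t) x - FunctionSpaces.Torus.gradient (p t) x -
            FunctionSpaces.Torus.convect (v t) (v t) x - ν • fracLaplacian θ (v t) x, ψ t x⟫_ℝ := by
      intro x
      have h1 : HasDerivWithinAt (fun τ => v τ x) (FunctionSpaces.Torus.timeDerivWithin I v t x) I t :=
        hv.hasDerivWithinAt_slice htI x
      have h2 : HasDerivWithinAt (fun τ => ψ τ x) (FunctionSpaces.Torus.timeDeriv ψ t x) I t := by
        obtain ⟨y, rfl⟩ := FunctionSpaces.Torus.proj_surjective x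
        have hd : Differentiable ℝ (fun τ : ℝ => FunctionSpaces.Torus.stLift ψ (τ, y)) :=
          (hψ.differentiable (by simp)).comp (differentiable_id.prodMk (differentiable_const y))
        exact (hd t).hasDerivAt.hasDerivWithinAt
      have h12 := (h1.inner ℝ h2).derivWithin (hU t htI)
      have hm := hI.momentum t htI x
      have h3 : FunctionSpaces.Torus.timeDerivWithin I v t x =
          tensorDivergence (R t) x - FunctionSpaces.Torus.gradient (p t) x -
            FunctionSpaces.Torus.convect (v t) (v t) x - ν • fracLaplacian θ (v t) x := by
        rw [← hm]; abel
      rw [FunctionSpaces.Torus.timeDerivWithin, h12, h3]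
    have i1 : Integrable (fun x => ⟪v t x, FunctionSpaces.Torus.timeDeriv ψ t x⟫_ℝ) volume :=
      (hvt.inner hψ't).integrable
    have i2 : Integrable (fun x => ⟪v t x, FunctionSpaces.Torus.convect (v t) (ψ t) x⟫_ℝ) volume :=
      (hvt.inner (hvt.convect hψt)).integrable
    have i12 : Integrable (fun x => ⟪v t x, FunctionSpaces.Torus.timeDeriv ψ t x⟫_ℝ +
        ⟪v t x, FunctionSpaces.Torus.convect (v t) (ψ t) x⟫_ℝ) volume := i1.add i2
    have i3 : Integrable (fun x => ν * ⟪v t x, fracLaplacian θ (ψ t) x⟫_ℝ) volume :=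
      ((hvt.continuous.inner hΛψ).integrable_unitAddTorus).const_mul ν
    have iD : Integrable (fun x => ⟪tensorDivergence (R t) x, ψ t x⟫_ℝ) volume :=
      (hRt.tensorDivergence.inner hψt).integrable
    have iG : Integrable (fun x => ⟪FunctionSpaces.Torus.gradient (p t) x, ψ t x⟫_ℝ) volume :=
      (hpt.gradient.inner hψt).integrable
    have iC : Integrable (fun x => ⟪FunctionSpaces.Torus.convect (v t) (v t) x, ψ t x⟫_ℝ) volume :=
      ((hvt.convect hvt).inner hψt).integrable
    have iL : Integrable (fun x => ⟪ν • fracLaplacian θ (v t) x, ψ t x⟫_ℝ) volume :=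
      ((hΛv.const_smul ν).inner hψt.continuous).integrable_unitAddTorus
    have hgrad : ∫ x, ⟪FunctionSpaces.Torus.gradient (p t) x, ψ t x⟫_ℝ = 0 :=
      FunctionSpaces.Torus.integral_inner_gradient_eq_zero_of_isDivFree hψt hpt (hψdiv t)
    have hconv : ∫ x, ⟪FunctionSpaces.Torus.convect (v t) (v t) x, ψ t x⟫_ℝ =
        -∫ x, ⟪v t x, FunctionSpaces.Torus.convect (v t) (ψ t) x⟫_ℝ :=
      FunctionSpaces.Torus.integral_inner_convect_eq_neg hvt (hI.divFree t htI) hvt hψt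
    have hdivR : ∫ x, ⟪tensorDivergence (R t) x, ψ t x⟫_ℝ = -B t :=
      integral_inner_tensorDivergence hRt hψt
    have hlap : ∫ x, ⟪ν • fracLaplacian θ (v t) x, ψ t x⟫_ℝ = ν * A₂ t := by
      simp_rw [real_inner_smul_left, integral_const_mul]
      rw [integral_inner_fracLaplacian_comm hθ hvt hψt]
    have iDG : Integrable (fun x => ⟪tensorDivergence (R t) x, ψ t x⟫_ℝ -
        ⟪FunctionSpaces.Torus.gradient (p t) x, ψ t x⟫_ℝ) volume := iD.sub iG
    have iDGC : Integrable (fun x => ⟪tensorDivergence (R t) x, ψ t x⟫_ℝ -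
        ⟪FunctionSpaces.Torus.gradient (p t) x, ψ t x⟫_ℝ -
        ⟪FunctionSpaces.Torus.convect (v t) (v t) x, ψ t x⟫_ℝ) volume := iDG.sub iC
    have iDGCL : Integrable (fun x => ⟪tensorDivergence (R t) x, ψ t x⟫_ℝ -
        ⟪FunctionSpaces.Torus.gradient (p t) x, ψ t x⟫_ℝ -
        ⟪FunctionSpaces.Torus.convect (v t) (v t) x, ψ t x⟫_ℝ -
        ⟪ν • fracLaplacian θ (v t) x, ψ t x⟫_ℝ) volume := iDGC.sub iL
    refine ⟨?_, ?_⟩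
    · simp only [hE'_def, hA₁_def]
      simp_rw [hslice, inner_sub_left]
      rw [integral_add i1 iDGCL, integral_sub iDGC iL, integral_sub iDG iC, integral_sub iD iG,
        hgrad, hconv, hdivR, hlap, integral_add i1 i2]
      ring
    · rw [integral_sub i12 i3, integral_const_mul]
  -- integrate in time
  have h0 : ∫ t in Ioo T₁ T₂, (A₁ t - ν * A₂ t - B t) = 0 :=
    (setIntegral_congr_fun measurableSet_Ioo fun t ht => ((hkey t ht).1).symm).trans hFTC
  have hAint : IntegrableOn (fun t => A₁ t - ν * A₂ t) (Ioo T₁ T₂) volume :=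
    hA₁int.sub (hA₂int.const_mul ν)
  have h1 : (∫ t in Ioo T₁ T₂, (A₁ t - ν * A₂ t)) - ∫ t in Ioo T₁ T₂, B t = 0 :=
    (integral_sub hAint hBint).symm.trans h0
  have h2 : ∫ t in Ioo T₁ T₂, ∫ x, (⟪v t x, FunctionSpaces.Torus.timeDeriv ψ t x⟫_ℝ +
      ⟪v t x, FunctionSpaces.Torus.convect (v t) (ψ t) x⟫_ℝ - ν * ⟪v t x, fracLaplacian θ (ψ t) x⟫_ℝ) =
      ∫ t in Ioo T₁ T₂, (A₁ t - ν * A₂ t) :=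
    setIntegral_congr_fun measurableSet_Ioo fun t ht => (hkey t ht).2
  rw [h2]
  exact sub_eq_zero.1 h1

omit [Fintype d] [DecidableEq d] in
/-- If `ψ` vanishes for all times `≤ a`, then `∂ₜψ(t) = 0` for `t < a`. [folklore] -/
theorem timeDeriv_eq_zero_of_forall_le {F : Type*} [NormedAddCommGroup F] [NormedSpace ℝ F]
    {ψ : ℝ → UnitAddTorus d → F} {a t : ℝ} (h : ∀ τ, τ ≤ a → ψ τ = 0) (ht : t < a)
    (x : UnitAddTorus d) : FunctionSpaces.Torus.timeDeriv ψ t x = 0 := by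
  have hev : (fun τ => ψ τ x) =ᶠ[𝓝 t] fun _ => (0 : F) := by
    filter_upwards [Iio_mem_nhds ht] with τ hτ
    rw [h τ (le_of_lt hτ), Pi.zero_apply]
  change deriv (fun τ => ψ τ x) t = 0
  rw [hev.deriv_eq, deriv_const]

omit [Fintype d] [DecidableEq d] in
/-- If `ψ` vanishes for all times `≥ b`, then `∂ₜψ(t) = 0` for `t > b`. [folklore] -/
theorem timeDeriv_eq_zero_of_forall_ge {F : Type*} [NormedAddCommGroup F] [NormedSpace ℝ F]
    {ψ : ℝ → UnitAddTorus d → F} {b t : ℝ} (h : ∀ τ, b ≤ τ → ψ τ = 0) (ht : b < t)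
    (x : UnitAddTorus d) : FunctionSpaces.Torus.timeDeriv ψ t x = 0 := by
  have hev : (fun τ => ψ τ x) =ᶠ[𝓝 t] fun _ => (0 : F) := by
    filter_upwards [Ioi_mem_nhds ht] with τ hτ
    rw [h τ (le_of_lt hτ), Pi.zero_apply]
  change deriv (fun τ => ψ τ x) t = 0
  rw [hev.deriv_eq, deriv_const]

/-- **The weak identity with Reynolds defect on the whole time line**: for a classical solution
of the fractional Navier–Stokes–Reynolds system on `ℝ × T^d` (`θ ≥ 0`) and every test field `ψ`
with smooth space–time lift, compact support in time and divergence free at every time,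
`∫_ℝ ∫ (⟪v, ∂ₜψ⟫ + ⟪v, (v·∇)ψ⟫ - ν ⟪v, (-Δ)^θ ψ⟫) dx dt = ∫_ℝ ∫ ∑ⱼ ⟪R^{(j)}, ∂ⱼψ⟫ dx dt`;
in particular, where `R = 0` the velocity satisfies the weak momentum identity of
`Torus.IsWeakFracNSSolutionLine` (Luo–Titi 2020, Def. 1.1).
[cite: LuoTiti2020, §1 Def. 1.1 and §2.1, proof of Theorem 1] -/
theorem IsFracNSReynoldsOn.weak_identity_line (h : IsFracNSReynoldsOn univ θ ν v p R) (hθ : 0 ≤ θ)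
    {ψ : ℝ → UnitAddTorus d → EuclideanSpace ℝ d} (hψ : ContDiff ℝ ∞ (FunctionSpaces.Torus.stLift ψ))
    {a b : ℝ} (hab : ∀ t, t ∉ Icc a b → ψ t = 0) (hψdiv : FunctionSpaces.Torus.IsDivFreeTest ψ) :
    ∫ t, ∫ x, (⟪v t x, FunctionSpaces.Torus.timeDeriv ψ t x⟫_ℝ +
        ⟪v t x, FunctionSpaces.Torus.convect (v t) (ψ t) x⟫_ℝ - ν * ⟪v t x, fracLaplacian θ (ψ t) x⟫_ℝ) =
      ∫ t, ∫ x, ∑ j, ⟪R t x j, FunctionSpaces.Torus.partialDeriv j (ψ t) x⟫_ℝ := by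
  -- `ψ` and all its derivatives vanish off `[a, b]`; work on `(T₁, T₂) ⊇ [a, b]`
  set T₁ : ℝ := min a b - 1 with hT₁_def
  set T₂ : ℝ := max a b + 1 with hT₂_def
  have hlt : T₁ < T₂ := by
    have := min_le_max (a := a) (b := b)
    rw [hT₁_def, hT₂_def]; linarith
  have hψa' : ∀ τ, τ ≤ min a b - 1 / 2 → ψ τ = 0 := fun τ hτ =>
    hab τ fun hm => by linarith [hm.1, min_le_left a b]
  have hψb' : ∀ τ, max a b + 1 / 2 ≤ τ → ψ τ = 0 := fun τ hτ =>
    hab τ fun hm => by linarith [hm.2, le_max_right a b]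
  have hψa : ψ T₁ = 0 := hψa' T₁ (by rw [hT₁_def]; linarith)
  have hψb : ψ T₂ = 0 := hψb' T₂ (by rw [hT₂_def]; linarith)
  have hzero : ∀ t, t ∉ Ioo T₁ T₂ →
      (∀ x, FunctionSpaces.Torus.timeDeriv ψ t x = 0) ∧ ψ t = 0 := by
    intro t ht
    simp only [mem_Ioo, not_and_or, not_lt] at ht
    rcases ht with ht | ht
    · have ht' : t ≤ min a b - 1 := ht
      exact ⟨fun x => timeDeriv_eq_zero_of_forall_le hψa' (by linarith) x, hψa' t (by linarith)⟩
    · have ht' : max a b + 1 ≤ t := ht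
      exact ⟨fun x => timeDeriv_eq_zero_of_forall_ge hψb' (by linarith) x, hψb' t (by linarith)⟩
  have hL : ∀ t, t ∉ Ioo T₁ T₂ →
      (∫ x, (⟪v t x, FunctionSpaces.Torus.timeDeriv ψ t x⟫_ℝ +
        ⟪v t x, FunctionSpaces.Torus.convect (v t) (ψ t) x⟫_ℝ - ν * ⟪v t x, fracLaplacian θ (ψ t) x⟫_ℝ)) = 0 := by
    intro t ht
    obtain ⟨h1, h2⟩ := hzero t ht
    have h2' : ψ t = fun _ => 0 := by rw [h2]; rfl
    have h3 : fracLaplacian θ (fun _ : UnitAddTorus d => (0 : EuclideanSpace ℝ d)) = 0 :=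
      fracLaplacian_zero_fun θ
    simp [h1, h2', h3, convect_zero_right]
  have hRz : ∀ t, t ∉ Ioo T₁ T₂ →
      (∫ x, ∑ j, ⟪R t x j, FunctionSpaces.Torus.partialDeriv j (ψ t) x⟫_ℝ) = 0 := by
    intro t ht
    obtain ⟨-, h2⟩ := hzero t ht
    have h2' : ψ t = fun _ => 0 := by rw [h2]; rfl
    have hpd : ∀ (j : d) (x : UnitAddTorus d),
        FunctionSpaces.Torus.partialDeriv j (fun _ : UnitAddTorus d => (0 : EuclideanSpace ℝ d)) x = 0 := by
      intro j x
      unfold FunctionSpaces.Torus.partialDeriv FunctionSpaces.Torus.lineDeriv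
      simp
    simp [h2', hpd]
  rw [← setIntegral_eq_integral_of_forall_compl_eq_zero hL,
    ← setIntegral_eq_integral_of_forall_compl_eq_zero hRz]
  exact h.weak_identity hθ (subset_univ _) hlt hψ hψa hψb hψdiv

end Torus

end Literature.Analysis.FluidPDE
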